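import Literature.AnabelianGeometry.SemiGraphs.ArithBranchGeometricPart
import Literature.AnabelianGeometry.SemiGraphs.ArithLevelData
import Literature.AnabelianGeometry.SemiGraphs.ArithEdgeLikeInfVerticial
import Literature.AnabelianGeometry.SemiGraphs.TemperedVerticialNotEdgeLike
import Literature.AnabelianGeometry.SemiGraphs.TemperedEdgeLikeIncomparable
import HarnessLib

/-!
# [SemiAnbd] Rmk 5.3.1 / Thm 5.4 for the PRODUCED decomposition data, from the chart action (proof-only)

Mochizuki, *Semi-graphs of Anabelioids*, Publ. RIMS **42** (2006) 221–322, §5: Rmk 5.3.1 p. 65 ("the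
intersection with `Π^temp_𝔾` of a verticial (resp. edge-like) subgroup of `Π^temp_𝔊` is a verticial
(resp. edge-like) subgroup of `Π^temp_𝔾` in the sense of Theorem 3.7"), p. 65 ("well-defined up to
conjugation in `Π^temp_𝔊` … the commensurator … of `Π^temp_{𝔾,v}`"), Thm 5.4 (ii) p. 66.
[cite: MochizukiSemiAnbd2006, Rmk 5.3.1, p. 65]

PROOF-ONLY companion (abc-iut cell, L3 sub-DAG #4 `plan/L3/SUBDAG-SemiAnbd-Thm54.md`, rows T54-2 /
T54-4e and the menu inputs **hVE**, **H-inc** of coordinator abc-iut-w4-d085's interface menu v2; seat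
abc-iut-w4-d040) — the LEVEL A COROLLARIES over abc-iut-w4-d053's produced data
`decompositionDataOfChart R ι` (`ArithDecompositionData.lean`) and hypothesis package
`ArithChartAction c ι aug actV actE actB` (`ArithLevelData.lean`, Def 5.1 (i) seen on the tempered
chart).  No definition, no new named fact.

* (H-OUT) — "conjugation by `g ∈ Π^temp_𝔊` carries images of verticial (edge-like) subgroups of
  `π₁^temp(𝒢)` to such images" — is READ OFF the package: `ArithChartAction.conj_isGeomVerticial`,
  `ArithChartAction.conj_isGeomEdgeLike`.
* With it, the typed second sentence of Rmk 5.3.1 (`IntersectionWithGeometricStatement`, row T54-2)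
  HOLDS for the produced data: `intersectionWithGeometricStatement_ofChart_of_action` — modulo only the
  named §3 fact `CompactInVerticial` (Thm 3.7 (iii), carried as by abc-iut-L3-t11 / abc-iut-w4-d085; it
  enters through the branch half `ArithBranchGeometricPart.lean`); its vertex clause alone is free of it
  (`isGeomVerticial_inf_ker_of_isVerticial_ofChart`).
* Consequences for the Thm 5.4 (ii) assembly over the produced data: **hVE** "no verticial subgroup of
  `Π^temp_𝔊` is edge-like" (`not_isEdgeLike_of_isVerticial_ofChart_of_action` = abc-iut-w4-d085's
  `not_isEdgeLike_of_isVerticial_of_geometric` ∘ the above ∘ the geometric `hne`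
  `isGeomVerticial_not_isGeomEdgeLike`), and **H-inc** "verticial subgroups of `Π^temp_𝔊` are pairwise
  incomparable" (`isVerticial_eq_of_le_ofChart_of_action`, free of `CompactInVerticial`:
  `isVerticial_eq_of_le` ∘ vertex clause ∘ `hcomm_v` ∘ hgeom_V `map_verticial_eq_of_le`).

What remains hypothesis: the package `ArithChartAction` itself (producer debt, row T54-B) and
`CompactInVerticial`.  Nothing here takes a side on [IUTchIII] Cor. 3.12; typed ≠ proved elsewhere.
-/

namespace Literature.AnabelianGeometry.SemiGraphs

namespace ProfiniteSemiGraph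

open CategoryTheory Topology
open scoped Pointwise

universe u u' u''

variable {𝒢 : ProfiniteSemiGraph.{u}} {c : TemperedPiChart 𝒢} {Gtp : Type u'} [Group Gtp]
  {PA : Type u''} [Group PA] [TopologicalSpace PA]

/-! ### (H-OUT) read off the chart action -/

/-- **(H-OUT), vertex half, from the chart action** (p. 65 "well-defined up to conjugation in
`Π^temp_𝔊`"; Prop 3.6 (iv) at `ρ(aug g)`): conjugation by any `g ∈ Π^temp_𝔊` carries the image of a
verticial subgroup of `π₁^temp(𝒢)` to the image of a verticial subgroup.
[cite: MochizukiSemiAnbd2006, Def 5.1 (i) / §5, pp. 62, 65] -/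
theorem ArithChartAction.conj_isGeomVerticial {ι : c.G →* Gtp} {aug : Gtp →* PA}
    {actV : PA → 𝒢.graph.Vertex → 𝒢.graph.Vertex} {actE : PA → 𝒢.graph.Edge → 𝒢.graph.Edge}
    {actB : PA → 𝒢.graph.Branch → 𝒢.graph.Branch} (A : ArithChartAction c ι aug actV actE actB)
    (g : Gtp) (K : Subgroup Gtp)
    (hK : ∃ w : 𝒢.graph.Vertex, ∃ H ∈ verticialSubgroups c w, K = H.map ι) :
    ∃ w : 𝒢.graph.Vertex, ∃ H ∈ verticialSubgroups c w, conjSubgroup g K = H.map ι := by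
  obtain ⟨w, H, hH, rfl⟩ := hK
  obtain ⟨H', hH', hEq⟩ := A.conj_verticial g w H hH
  exact ⟨actV (aug g) w, H', hH', hEq⟩

/-- **(H-OUT), edge half, from the chart action**: conjugation by any `g ∈ Π^temp_𝔊` carries the image
of an edge-like subgroup of `π₁^temp(𝒢)` to the image of an edge-like subgroup.
[cite: MochizukiSemiAnbd2006, Def 5.1 (i) / §5, pp. 62, 65] -/
theorem ArithChartAction.conj_isGeomEdgeLike {ι : c.G →* Gtp} {aug : Gtp →* PA}
    {actV : PA → 𝒢.graph.Vertex → 𝒢.graph.Vertex} {actE : PA → 𝒢.graph.Edge → 𝒢.graph.Edge}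
    {actB : PA → 𝒢.graph.Branch → 𝒢.graph.Branch} (A : ArithChartAction c ι aug actV actE actB)
    (g : Gtp) (K : Subgroup Gtp)
    (hK : ∃ e : 𝒢.graph.Edge, ∃ L ∈ edgeLikeSubgroups c e, K = L.map ι) :
    ∃ e : 𝒢.graph.Edge, ∃ L ∈ edgeLikeSubgroups c e, conjSubgroup g K = L.map ι := by
  obtain ⟨e, L, hL, rfl⟩ := hK
  obtain ⟨L', hL', hEq⟩ := A.conj_edgeLike g e L hL
  exact ⟨actE (aug g) e, L', hL', hEq⟩

/-! ### Rmk 5.3.1 (second sentence) for the produced data -/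

/-- **The typed second sentence of Rmk 5.3.1 HOLDS for the produced data** `decompositionDataOfChart R ι`
(row T54-2 at LEVEL A), given the chart action (Def 5.1 (i)) and modulo the named §3 fact
`CompactInVerticial` (Thm 3.7 (iii)): the geometric part `K ∩ Ker aug` of every verticial (resp.
edge-like) subgroup `K` of `Π^temp_𝔊` is the image of a verticial (resp. edge-like) subgroup of
`π₁^temp(𝒢)`. [cite: MochizukiSemiAnbd2006, Rmk 5.3.1, p. 65] -/
theorem intersectionWithGeometricStatement_ofChart_of_action (hCV : CompactInVerticial.{u})
    (h𝒢 : 𝒢.Thm37Hypotheses) (hG : 𝒢.graph.IsGraph) (R : ChartRepresentatives c) (ι : c.G →* Gtp)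
    (hι : Function.Injective ι) (aug : Gtp →* PA) (hexact : ι.range = aug.ker)
    {actV : PA → 𝒢.graph.Vertex → 𝒢.graph.Vertex} {actE : PA → 𝒢.graph.Edge → 𝒢.graph.Edge}
    {actB : PA → 𝒢.graph.Branch → 𝒢.graph.Branch} (A : ArithChartAction c ι aug actV actE actB) :
    IntersectionWithGeometricStatement (decompositionDataOfChart R ι) aug
      (fun K => ∃ w : 𝒢.graph.Vertex, ∃ H ∈ verticialSubgroups c w, K = H.map ι)
      (fun K => ∃ e : 𝒢.graph.Edge, ∃ L ∈ edgeLikeSubgroups c e, K = L.map ι) :=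
  intersectionWithGeometricStatement_ofChart hCV h𝒢 hG R ι hι aug hexact A.conj_isGeomVerticial
    A.conj_isGeomEdgeLike

/-- **The vertex clause alone is free of `CompactInVerticial`**: for the produced data and the chart
action, the geometric part of every verticial subgroup of `Π^temp_𝔊` is the image of a verticial subgroup
of `π₁^temp(𝒢)` (vertex half of Rmk 5.3.1; the edge predicate is specialised to `True`).
[cite: MochizukiSemiAnbd2006, Rmk 5.3.1, p. 65] -/
theorem isGeomVerticial_inf_ker_of_isVerticial_ofChart (h𝒢 : 𝒢.Thm37Hypotheses)
    (R : ChartRepresentatives c) (ι : c.G →* Gtp) (hι : Function.Injective ι) (aug : Gtp →* PA)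
    (hexact : ι.range = aug.ker)
    {actV : PA → 𝒢.graph.Vertex → 𝒢.graph.Vertex} {actE : PA → 𝒢.graph.Edge → 𝒢.graph.Edge}
    {actB : PA → 𝒢.graph.Branch → 𝒢.graph.Branch} (A : ArithChartAction c ι aug actV actE actB) :
    IntersectionWithGeometricStatement (decompositionDataOfChart R ι) aug
      (fun K => ∃ w : 𝒢.graph.Vertex, ∃ H ∈ verticialSubgroups c w, K = H.map ι) (fun _ => True) :=
  intersectionWithGeometricStatement_of (decompositionDataOfChart R ι) aug _ _
    (fun v => (decompositionDataOfChart_vertGp_inf_ker h𝒢 R ι hι aug hexact v).1)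
    A.conj_isGeomVerticial (fun _ => trivial) (fun _ _ _ => trivial)

/-! ### Consequences: hVE and H-inc for the produced data -/

/-- **hVE for the produced data: no verticial subgroup of `Π^temp_𝔊` is edge-like** (the input `hVE` of
the Thm 5.4 (ii) assembly, route of record: Rmk 5.3.1 second sentence + the geometric fact "a verticial
subgroup of `π₁^temp(𝒢)` is not edge-like", `isGeomVerticial_not_isGeomEdgeLike`), given the chart action
and modulo `CompactInVerticial`. [cite: MochizukiSemiAnbd2006, Thm 5.4 (ii), p. 66] -/
theorem not_isEdgeLike_of_isVerticial_ofChart_of_action (hCV : CompactInVerticial.{u})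
    (h𝒢 : 𝒢.Thm37Hypotheses) (hG : 𝒢.graph.IsGraph) (R : ChartRepresentatives c) (ι : c.G →* Gtp)
    (hι : Function.Injective ι) (aug : Gtp →* PA) (hexact : ι.range = aug.ker)
    {actV : PA → 𝒢.graph.Vertex → 𝒢.graph.Vertex} {actE : PA → 𝒢.graph.Edge → 𝒢.graph.Edge}
    {actB : PA → 𝒢.graph.Branch → 𝒢.graph.Branch} (A : ArithChartAction c ι aug actV actE actB)
    {K : Subgroup Gtp} (hK : IsVerticial (decompositionDataOfChart R ι) K) :
    ¬ IsEdgeLike (decompositionDataOfChart R ι) K :=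
  not_isEdgeLike_of_isVerticial_of_geometric
    (intersectionWithGeometricStatement_ofChart_of_action hCV h𝒢 hG R ι hι aug hexact A)
    (fun K hKv => isGeomVerticial_not_isGeomEdgeLike h𝒢 c ι hι K hKv) hK

/-- **H-inc for the produced data: verticial subgroups of `Π^temp_𝔊` are pairwise incomparable**
(nested ⇒ equal), given the chart action and FREE of `CompactInVerticial`: the geometric parts are nested
images of verticial subgroups of `π₁^temp(𝒢)`, equal by Thm 3.7 (ii) (`map_verticial_eq_of_le`), and the
commensurator description `C(W ∩ Ker aug) = W` (p. 65; `decompositionDataOfChart_vertGp_inf_ker`)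
recovers `W`, `W'`. [cite: MochizukiSemiAnbd2006, Thm 3.7 (ii) / §5, pp. 40, 65] -/
theorem isVerticial_eq_of_le_ofChart_of_action (h𝒢 : 𝒢.Thm37Hypotheses) (R : ChartRepresentatives c)
    (ι : c.G →* Gtp) (hι : Function.Injective ι) (aug : Gtp →* PA) (hexact : ι.range = aug.ker)
    {actV : PA → 𝒢.graph.Vertex → 𝒢.graph.Vertex} {actE : PA → 𝒢.graph.Edge → 𝒢.graph.Edge}
    {actB : PA → 𝒢.graph.Branch → 𝒢.graph.Branch} (A : ArithChartAction c ι aug actV actE actB)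
    {W W' : Subgroup Gtp} (hW : IsVerticial (decompositionDataOfChart R ι) W)
    (hW' : IsVerticial (decompositionDataOfChart R ι) W') (hle : W ≤ W') : W = W' :=
  isVerticial_eq_of_le (decompositionDataOfChart R ι) aug _ _
    (isGeomVerticial_inf_ker_of_isVerticial_ofChart h𝒢 R ι hι aug hexact A)
    (fun v => (decompositionDataOfChart_vertGp_inf_ker h𝒢 R ι hι aug hexact v).2)
    (fun _ _ hH hH' hle' => map_verticial_eq_of_le c ι verticialDistinct_holds h𝒢 hι hH hH' hle')
    hW hW' hle

end ProfiniteSemiGraph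

end Literature.AnabelianGeometry.SemiGraphs
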